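import Literature.AlgebraicGeometry.AbelianSchemes.AbelianSchemeConstSubgroupQuotient
import Literature.AlgebraicGeometry.RelativeSpec.GeometricQuotientGroupLaw
import HarnessLib

/-!
# Multiplication by `n` descends along the quotient `ψ : A → A/K` by an `n`-torsion constant subgroup (HECKE-LINK H2, D0)

Layer `Literature/AlgebraicGeometry/AbelianSchemes`, namespace `Literature.AlgebraicGeometry.AbelianSchemes.AbelianSchemeOver`.
Cell `hodgecm-mathlib`, HECKE-LINK line card v1.1 §3, step D0 of the two-step descent of the census
`B-provers/B-p20/g9/CENSUS-H2-DualPairOfQuotient.B-p20g9.md`, over ★ file (i) `AbelianSchemes/AbelianSchemeConstSubgroupQuotient`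
(p742166: `quotientOver`, `quotientMk = ψ`, `quotientBy = A/K`) and ★ `RelativeSpec/GeometricQuotientGroupLaw` (p742177: `ψ`,
`ψ ⊗ₘ ψ` are epimorphisms).  [MumfordAV1970] §7 Thm. 4 (p. 72): for a finite subgroup `K ⊆ A[n]` the isogeny `[n]_A`
factors through `A → A/K`.  Here, for an abelian scheme `A → S` which is COMMUTATIVE as a group object (★
`isCommMonObj_of_isReduced_base` over any reduced base) and a finite constant subgroup `K ⊆ A[n](S)` of sections:
`mulN n = [n]_A := (𝟙_A)^n` is a homomorphism invariant under the translations `t_σ`, `σ ∈ K`, hence DESCENDS along `ψ`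
to **`mulNDesc = π : A/K → A`** (DEFINITION, underlying map ★ `gluedDesc`) with `ψ ≫ π = [n]_A` (`quotientMk_comp_mulNDesc`),
`π ≫ ψ = [n]_{A/K}` (`mulNDesc_comp_quotientMk`) and `π` a HOMOMORPHISM for the descended group law (`isMonHom_mulNDesc`),
the last two after cancelling the epimorphisms `ψ`, `ψ ⊗ₘ ψ`.  This `π` is the map the Hecke-link's polarisation descent
(H2c, `ψ̂ ∘ λ_B ∘ ψ = n·λ`) and file (ii) (`B̂ := Â/K′`, `K′ = ker π^*`) read.  Definitions with bodies + theorems; no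
`Prop`-valued def, no instance, no sorry.  HC_CM is proved only modulo the 7 printed citations until rung 0 closes; nothing
here is about HC.

## References
* [MumfordAV1970] D. Mumford, *Abelian Varieties* (1970), §7 Thm. 4 (p. 72); §15 Thm. 1 (p. 143).
* [MumfordFogartyKirwan1994] D. Mumford, J. Fogarty, F. Kirwan, *GIT*, Ch. 6 §1 (p. 115), Ch. 7 §1 Prop. 7.1 (p. 127).
-/

noncomputable section

universe u

open CategoryTheory CategoryTheory.Limits AlgebraicGeometry MonoidalCategory CartesianMonoidalCategory
open scoped MonObj

namespace Literature.AlgebraicGeometry.AbelianSchemes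

namespace AbelianSchemeOver

open Literature.AlgebraicGeometry.RelativeSpec

variable {S : Scheme.{u}} (A : AbelianSchemeOver S)

/-! ## §1 (D0) Multiplication by `n` descends along `ψ : A → A/K` -/

/-- Multiplication by `n` on the `S`-group scheme `A`: the `n`-th power of `𝟙_A` in `Hom_S(A, A)`.
[cite: MumfordFogartyKirwan1994, Ch. 6 §1 (p. 115)] -/
def mulN (n : ℕ) : A.X ⟶ A.X := (𝟙 A.X) ^ n

/-- Unfolding. [cite: MumfordFogartyKirwan1994, Ch. 6 §1 (p. 115)] -/
theorem mulN_def (n : ℕ) : A.mulN n = (𝟙 A.X) ^ n := rfl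

/-- For a COMMUTATIVE group scheme, the product of two homomorphisms into it is a homomorphism.
[cite: MumfordFogartyKirwan1994, Ch. 6 §1 Cor. 6.5 (p. 117)] -/
theorem isMonHom_mul [IsCommMonObj A.X] {T : Over S} [MonObj T] (f g : T ⟶ A.X) [IsMonHom f] [IsMonHom g] :
    IsMonHom (f * g) := by
  rw [Hom.mul_def]; infer_instance

/-- `[n]` is a homomorphism (commutative `A`). [cite: MumfordFogartyKirwan1994, Ch. 6 §1 Cor. 6.5 (p. 117)] -/
theorem isMonHom_mulN [IsCommMonObj A.X] (n : ℕ) : IsMonHom (A.mulN n) := by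
  induction n with
  | zero => rw [mulN_def, pow_zero, Hom.one_def]; infer_instance
  | succ n ih =>
    rw [mulN_def, pow_succ]
    haveI : IsMonHom ((𝟙 A.X) ^ n) := ih
    exact A.isMonHom_mul _ _

/-- **`[n]` is invariant under translation by an `n`-torsion section**: `t_σ ≫ [n] = [n]` for `σ ^ n = 1` (commutative
`A`: `n·(σ x) = σ^n · (n·x)`). [cite: MumfordAV1970, §7 Thm. 4 (p. 72)] -/
theorem translation_comp_mulN [IsCommMonObj A.X] (σ : A.Sections) (n : ℕ) (hσ : σ ^ n = 1) :
    A.translation σ ≫ A.mulN n = A.mulN n := by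
  rw [mulN_def, MonObj.comp_pow, Category.comp_id, translation, mul_pow, ← MonObj.comp_pow, hσ, MonObj.comp_one,
    one_mul]

section Descent

variable {Y : Scheme.{u}} (u : S ⟶ Y) (K : Subgroup A.Sections) [IsCommMonObj A.X] {n : ℕ}
  (hK : ∀ σ : K, (σ : A.Sections) ^ n = 1)

include hK in
/-- `[n].left` is invariant under the translation action of `K ⊆ A[n](S)`. [cite: MumfordAV1970, §7 Thm. 4 (p. 72)] -/
theorem aut_hom_comp_mulN_left (σ : K) :
    ((A.translationActionOver u K).aut σ).hom ≫ (A.mulN n).left = (A.mulN n).left := by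
  rw [translationActionOver_aut_hom, ← Over.comp_left, A.translation_comp_mulN _ n (hK σ)]

variable [Finite K] [Y.IsSeparated] [IsSeparated (A.X.hom ≫ u)] [S.IsSeparated]
  (hcov : ∀ x : A.left, ∃ O : (A.translationActionOver u K).StableAffineOpens, x ∈ O.1)

omit [IsCommMonObj A.X] [Finite K] [Y.IsSeparated] [IsSeparated (A.X.hom ≫ u)] in
/-- The total space of `A` is separated when `S` and `A → S` are. [cite: MumfordFogartyKirwan1994, Ch. 6 §1 (p. 115)] -/
theorem isSeparated_left_of_base [IsSeparated A.X.hom] : A.left.IsSeparated := by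
  refine ⟨?_⟩
  rw [← terminal.comp_from A.X.hom]
  infer_instance

/-- **`π : A/K → A`, the descent of `[n]` along `ψ`** (for `K ⊆ A[n](S)`, commutative `A`): the underlying map is ★
`gluedDesc` of `[n].left`, which is `K`-invariant. [cite: MumfordAV1970, §7 Thm. 4 (p. 72)] -/
def mulNDesc : A.quotientOver u K ⟶ A.X :=
  haveI : IsSeparated A.X.hom := IsSeparated.of_comp A.X.hom u
  haveI : A.left.IsSeparated := A.isSeparated_left_of_base
  Over.homMk ((A.translationActionOver u K).gluedDesc (A.mulN n).left (A.aut_hom_comp_mulN_left u K hK)) (by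
    show _ = (A.translationActionOver u K).gluedDesc A.X.hom (A.aut_hom_comp_hom u K)
    refine (A.translationActionOver u K).glued_hom_ext hcov ?_
    exact ((A.translationActionOver u K).gluedMk_gluedDesc_assoc hcov _ _ _).trans
      ((Over.w (A.mulN n)).trans ((A.translationActionOver u K).gluedMk_gluedDesc hcov _ _).symm))

/-- **`ψ ≫ π = [n]_A`.** [cite: MumfordAV1970, §7 Thm. 4 (p. 72)] -/
theorem quotientMk_comp_mulNDesc : A.quotientMk u K hcov ≫ A.mulNDesc u K hK hcov = A.mulN n := by
  haveI : IsSeparated A.X.hom := IsSeparated.of_comp A.X.hom u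
  haveI : A.left.IsSeparated := A.isSeparated_left_of_base
  exact Over.OverMorphism.ext ((A.translationActionOver u K).gluedMk_gluedDesc hcov _ _)

variable [LocallyOfFiniteType (A.X.hom ≫ u)] [IsLocallyNoetherian Y]
  (hG : ∃ _ : GrpObj (A.quotientOver u K), IsMonHom (A.quotientMk u K hcov))
  (hsm : Smooth (A.quotientOver u K).hom) (hgc : GeometricallyConnected (A.quotientOver u K).hom)
  (hfree : ∀ (Ω : Type u) [Field Ω] [IsAlgClosed Ω] (x : Spec (.of Ω) ⟶ A.left) (σ : K), σ ≠ 1 →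
    x ≫ (A.translation (σ : A.Sections)).left ≠ x)

omit [IsCommMonObj A.X] [LocallyOfFiniteType (A.X.hom ≫ u)] [IsLocallyNoetherian Y] in
include hfree in
/-- `ψ.left` is flat (free geometric quotient, ★ `IsGeometricQuotient.flat_of_free`) — over an affine `Y`.
[cite: MumfordAV1970, §7 Thm. 4 (p. 72)] -/
private theorem flat_quotientMk_left' [IsAffine Y] : Flat (A.quotientMk u K hcov).left :=
  haveI := A.isAffineHom_quotientMk_left u K hcov
  haveI : Fintype K := Fintype.ofFinite K
  (A.isGeometricQuotient_quotientActionOver u K hcov).flat_of_free (A.quotientActionOver_free u K hcov hfree)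

omit [IsCommMonObj A.X] [LocallyOfFiniteType (A.X.hom ≫ u)] [IsLocallyNoetherian Y] in
include hfree in
/-- `ψ` is an epimorphism in `Over S` (flat + surjective, ★ `epi_of_flat_left`). [cite: MumfordAV1970, §7 Thm. 4 (p. 72)] -/
theorem epi_quotientMk [IsAffine Y] : Epi (A.quotientMk u K hcov) :=
  haveI := A.flat_quotientMk_left' u K hcov hfree
  haveI : Surjective (A.quotientMk u K hcov).left := ⟨A.quotientMk_left_surjective u K hcov⟩
  ActionOver.IsGeometricQuotient.epi_of_flat_left (A.quotientMk u K hcov)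

omit [IsCommMonObj A.X] [LocallyOfFiniteType (A.X.hom ≫ u)] [IsLocallyNoetherian Y] in
include hfree in
/-- `ψ ⊗ₘ ψ` is an epimorphism in `Over S`. [cite: MumfordAV1970, §7 Thm. 4 (p. 72)] -/
theorem epi_quotientMk_tensorHom [IsAffine Y] :
    Epi (A.quotientMk u K hcov ⊗ₘ A.quotientMk u K hcov) := by
  haveI := A.flat_quotientMk_left' u K hcov hfree
  haveI : Surjective (A.quotientMk u K hcov).left := ⟨A.quotientMk_left_surjective u K hcov⟩
  rw [tensorHom_def]
  haveI := ActionOver.IsGeometricQuotient.epi_whiskerRight (A.quotientMk u K hcov) (B := A.X)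
  haveI := ActionOver.IsGeometricQuotient.epi_whiskerLeft (A.quotientMk u K hcov) (B := A.quotientOver u K)
  exact epi_comp _ _

include hfree in
/-- **`π` is a homomorphism** for the descended group law of `A/K` (`η` and `μ` clauses checked after the epis `ψ`,
`ψ ⊗ₘ ψ`; `[n]` is a homomorphism because `A` is commutative). [cite: MumfordAV1970, §7 Thm. 4 (p. 72)] -/
theorem isMonHom_mulNDesc [IsAffine Y] :
    letI : GrpObj (A.quotientOver u K) := (A.quotientBy u K hcov hG hsm hgc).grpObj
    IsMonHom (A.mulNDesc u K hK hcov) := by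
  letI : GrpObj (A.quotientOver u K) := (A.quotientBy u K hcov hG hsm hgc).grpObj
  haveI := A.isMonHom_quotientMk u K hcov hG hsm hgc
  haveI := A.isMonHom_mulN n
  haveI := A.epi_quotientMk_tensorHom u K hcov hfree
  refine ⟨?_, ?_⟩
  · -- `η_{A/K} ≫ π = η_A`: `η_{A/K} = η_A ≫ ψ`
    rw [← IsMonHom.one_hom (A.quotientMk u K hcov), Category.assoc, quotientMk_comp_mulNDesc,
      IsMonHom.one_hom (A.mulN n)]
  · -- `μ_{A/K} ≫ π = (π ⊗ₘ π) ≫ μ_A`, after the epi `ψ ⊗ₘ ψ`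
    rw [← cancel_epi (A.quotientMk u K hcov ⊗ₘ A.quotientMk u K hcov), ← Category.assoc,
      ← IsMonHom.mul_hom (A.quotientMk u K hcov), Category.assoc, quotientMk_comp_mulNDesc, ← Category.assoc,
      tensorHom_comp_tensorHom, quotientMk_comp_mulNDesc, IsMonHom.mul_hom (A.mulN n)]

include hfree in
/-- **`π ≫ ψ = [n]_{A/K}`** (checked after the epi `ψ`: `ψ ≫ π ≫ ψ = [n]_A ≫ ψ = ψ ≫ [n]_{A/K}`).
[cite: MumfordAV1970, §7 Thm. 4 (p. 72)] -/
theorem mulNDesc_comp_quotientMk [IsAffine Y] :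
    letI : GrpObj (A.quotientOver u K) := (A.quotientBy u K hcov hG hsm hgc).grpObj
    A.mulNDesc u K hK hcov ≫ A.quotientMk u K hcov = (A.quotientBy u K hcov hG hsm hgc).mulN n := by
  letI : GrpObj (A.quotientOver u K) := (A.quotientBy u K hcov hG hsm hgc).grpObj
  haveI := A.isMonHom_quotientMk u K hcov hG hsm hgc
  haveI := A.epi_quotientMk u K hcov hfree
  rw [← cancel_epi (A.quotientMk u K hcov), ← Category.assoc, quotientMk_comp_mulNDesc]
  show A.mulN n ≫ A.quotientMk u K hcov = A.quotientMk u K hcov ≫ (𝟙 (A.quotientOver u K)) ^ n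
  rw [mulN_def, MonObj.pow_comp, MonObj.comp_pow, Category.id_comp, Category.comp_id]

end Descent

end AbelianSchemeOver

end Literature.AlgebraicGeometry.AbelianSchemes

end
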